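import Mathlib
import Literature.MathematicalPhysics.StatisticalMechanics.LennardJonesClusters
import Literature.MathematicalPhysics.StatisticalMechanics.BarlowStacking
import Literature.MathematicalPhysics.StatisticalMechanics.HcpHomogeneous
import Literature.MathematicalPhysics.StatisticalMechanics.PeriodicConfigurationSums
import Summits.AtomisticToContinuum.Crystallization.Theorems.PricedLinkCensusStackingHingeFarTail
import Summits.AtomisticToContinuum.Crystallization.Theorems.PricedLinkCensusStackingHingeSiteEnergyNearMatched
import Summits.AtomisticToContinuum.Crystallization.Theorems.MinMeanCycleStackingLockBarlowEnergyIdentification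

/-!
# Site energies of hcp-matched sites are `2 e(hcp)` up to `C (θ + ℓ⁻³)`

Let `S = barlowStacking a h alternatingHagg` (relaxed hcp, `a, h > 0`), `0 < δ₀ ≤ 1`,
`δ₀ ≤ min a h`, and let `y : Fin N → ℝ³` be `δ₀`-separated. Suppose the site `i` is `θ`-matched to
hcp at range `ℓ` (`ℓ ≥ 2`, `0 < θ ≤ δ₀/4`): there are a rigid motion `g` and `z₀ ∈ S` with
`|y i - g z₀| ≤ θ`, every `y j` with `|y i - y j| ≤ ℓ` is within `θ` of some `g z`, `z ∈ S`, and
every `g z`, `z ∈ S`, with `|y i - g z| ≤ ℓ` is within `θ` of some `y j`. Then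
`|𝓔ⁱ_LJ(y) - 2 e_LJ(hcp a h)| ≤ C(a, h, δ₀) (θ + ℓ⁻³)` (`stub_hcpMatchedSiteEnergy`, stub of line
Sketch of the crux `PricedLinkCensus.StackingHinge`, stmt-AtomisticToContinuum-14993). No
minimality of hcp is used.

Proof. (1) `2 e_LJ(hcp) = ∑'_{z ∈ S, z ≠ z₀} V_LJ(|z₀ - z|)` for every `z₀ ∈ S`
(`two_mul_energyPerParticle_hcp`): the energy per particle is the average over the two motif
points of the punctured lattice sums (`energyPerParticle_barlow_eq_average`,
`tsum_points_eq_two_mul_barlowSiteEnergy`), and that sum is the same at every site since hcp is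
homogeneous (`hcpStacking_homogeneous`, `tsum_hcp_site_eq`). (2) Comparison, as in
`PricedHcpWindowsSiteEnergyContinuity.stub_siteEnergyNearMatched`: the matching `j ↦ m j ∈ S` is
injective on the `ℓ`-ball and avoids `z₀` (separation, `2θ < δ₀`), with
`| |z₀ - m j| - |y i - y j| | ≤ 2θ`. Split `𝓔ⁱ(y)` over `{j ≠ i : |y i - y j| ≤ ℓ - 2θ}` and the
rest, and the lattice sum over the image of that set and the rest
(`Summable.sum_add_tsum_subtype_compl`). Matched terms differ by
`≤ 2θ (δ₀⁻⁷ + δ₀⁻¹)(|y i - y j|⁻⁶ + |z₀ - m j|⁻⁶)` (mean value theorem), summed by the shell bound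
`sum_inv_pow_six_le` (finite subsets of `S` are enumerated, `exists_fin_enum`). Unmatched sites
have `|y i - y j| > ℓ - 2θ ≥ ℓ/2`, unmatched lattice points have `|z₀ - z| > ℓ - 4θ ≥ ℓ/2` (one
within `ℓ - 4θ` would be matched back into the matched set); both tails are `≤ 8 C_tail ℓ⁻³` by
`PricedHcpWindowsFarTail.stub_farTail` (for the lattice on every finite partial sum,
`tsum_far_le`) and `|V_LJ(r)| ≤ r⁻⁶` for `r ≥ 1`. All `[folklore]`; no definitions.
-/

namespace Summit.AtomisticToContinuum.Crystallization.Theorems.PricedHcpWindowsMatchedEnergy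

open Filter Topology
open Literature.MathematicalPhysics.StatisticalMechanics
open PricedHcpWindowsSiteEnergyContinuity (abs_lennardJones_sub_le abs_lennardJones_le_of_one_le
  abs_add_sub_le_three)

/-! ## The punctured lattice sum of hcp is the same at every site and equals `2 e(hcp)` -/

/-- **Homogeneity of hcp lattice sums**: for every `p₀ ∈ S = barlowStacking a h alternatingHagg`
and every `Φ`, `∑'_{z ∈ S, z ≠ p₀} Φ(|p₀ - z|) = ∑'_{z ∈ S, z ≠ 0} Φ(|z|)` — the bijection
`q ↦ p₀ + B q` of `S ∖ {0}` onto `S ∖ {p₀}` (`hcpStacking_homogeneous`) preserves the distances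
to the base point. [folklore] -/
theorem tsum_hcp_site_eq (a h : ℝ) (Φ : ℝ → ℝ) {p₀ : EuclideanSpace ℝ (Fin 3)}
    (hp₀ : p₀ ∈ barlowStacking a h alternatingHagg) :
    ∑' z : {z // z ∈ barlowStacking a h alternatingHagg ∧ z ≠ p₀}, Φ (dist p₀ z.1) =
      ∑' z : {z // z ∈ barlowStacking a h alternatingHagg ∧ z ≠ 0}, Φ (dist 0 z.1) := by
  obtain ⟨B, hB⟩ := hcpStacking_homogeneous a h hp₀
  let e : {z // z ∈ barlowStacking a h alternatingHagg ∧ z ≠ 0} →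
      {z // z ∈ barlowStacking a h alternatingHagg ∧ z ≠ p₀} := fun q =>
    ⟨p₀ + B q.1, (hB q.1).1 q.2.1, fun h0 => q.2.2 (B.map_eq_zero_iff.1 (add_eq_left.1 h0))⟩
  have he : Function.Bijective e := by
    refine ⟨fun q q' hqq' => ?_, fun z => ?_⟩
    · have h1 : p₀ + B q.1 = p₀ + B q'.1 := congrArg Subtype.val hqq'
      exact Subtype.ext (B.injective (add_left_cancel h1))
    · have hz : p₀ + B (B.symm (z.1 - p₀)) = z.1 := by rw [B.apply_symm_apply, add_sub_cancel]
      exact ⟨⟨B.symm (z.1 - p₀), (hB _).2 (by rw [hz]; exact z.2.1), fun h0 =>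
        z.2.2 (sub_eq_zero.1 (B.symm.map_eq_zero_iff.1 h0))⟩, Subtype.ext hz⟩
  rw [← (Equiv.ofBijective e he).tsum_eq]
  refine tsum_congr fun q => ?_
  simp only [Equiv.ofBijective_apply, e]
  rw [dist_eq_norm, dist_eq_norm, zero_sub, norm_neg, sub_add_cancel_left, norm_neg, B.norm_map]

/-- **The hcp site lattice sum is twice the energy per particle**: for `a, h > 0` and every
`z₀ ∈ S = barlowStacking a h alternatingHagg`,
`2 · e_LJ(hcpPeriodicConfiguration) = ∑'_{z ∈ S, z ≠ z₀} V_LJ(|z₀ - z|)` (average of the two motif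
site sums, `energyPerParticle_barlow_eq_average` and `tsum_points_eq_two_mul_barlowSiteEnergy`,
which agree with the sum at `z₀` by homogeneity). [folklore] -/
theorem two_mul_energyPerParticle_hcp {a h : ℝ} (ha0 : 0 < a) (hh0 : 0 < h) (ha : a ≠ 0)
    (hh : h ≠ 0) {z₀ : EuclideanSpace ℝ (Fin 3)}
    (hz₀ : z₀ ∈ barlowStacking a h alternatingHagg) :
    2 * (hcpPeriodicConfiguration ha hh).energyPerParticle lennardJones =
      ∑' z : {z // z ∈ barlowStacking a h alternatingHagg ∧ z ≠ z₀},
        lennardJones (dist z₀ z.1) := by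
  have hP : (barlowPeriodicConfiguration alternatingHagg ha hh two_ne_zero
      alternatingHagg_periodic).points = barlowStacking a h alternatingHagg :=
    barlowPeriodicConfiguration_points _ ha hh _ _
  have key : ∀ m : ℤ, 2 * barlowSiteEnergy lennardJones a h alternatingHagg m =
      ∑' z : {z // z ∈ barlowStacking a h alternatingHagg ∧ z ≠ 0},
        lennardJones (dist 0 z.1) := by
    intro m
    rw [← tsum_points_eq_two_mul_barlowSiteEnergy ha0 hh0 ha hh two_ne_zero
      alternatingHagg_periodic m, hP]
    exact tsum_hcp_site_eq a h lennardJones (barlowPos_mem _ _ _)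
  rw [hcpPeriodicConfiguration, energyPerParticle_barlow_eq_average ha0 hh0 ha hh two_ne_zero
    alternatingHagg_periodic, tsum_hcp_site_eq a h lennardJones hz₀, Finset.sum_range_succ,
    Finset.sum_range_one]
  obtain ⟨k0, k1⟩ := And.intro (key 0) (key 1)
  push_cast
  linarith

/-! ## Finite subsets of a separated set -/

/-- Enumeration of a finset `T ∋ z₀` of pairwise `≥ δ₀` separated points (of a metric space) as
a separated configuration `y : Fin N → X` with `y i = z₀`, transporting sums over `T ∖ {z₀}` to
sums over `k ≠ i` (so that the finite-configuration bounds `sum_inv_pow_six_le`, `stub_farTail`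
apply). [folklore] -/
theorem exists_fin_enum {X : Type*} [MetricSpace X] [DecidableEq X] {δ₀ : ℝ} (T : Finset X)
    {z₀ : X} (hz₀ : z₀ ∈ T) (hsep : ∀ c ∈ T, ∀ d ∈ T, c ≠ d → δ₀ ≤ dist c d) :
    ∃ (N : ℕ) (y : Fin N → X) (i : Fin N), y i = z₀ ∧ Function.Injective y ∧ (∀ k, y k ∈ T) ∧
      (∀ k l : Fin N, k ≠ l → δ₀ ≤ dist (y k) (y l)) ∧
      ∀ Φ : X → ℝ, ∑ z ∈ T.erase z₀, Φ z = ∑ k ∈ Finset.univ.erase i, Φ (y k) := by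
  have hinj : Function.Injective fun k => (T.equivFin.symm k).1 :=
    Subtype.val_injective.comp T.equivFin.symm.injective
  refine ⟨T.card, fun k => (T.equivFin.symm k).1, T.equivFin ⟨z₀, hz₀⟩, by simp, hinj,
    fun k => (T.equivFin.symm k).2, fun k l hkl => hsep _ (T.equivFin.symm k).2 _
      (T.equivFin.symm l).2 (hinj.ne hkl), fun Φ => ?_⟩
  have h1 : ∑ k : Fin T.card, Φ (T.equivFin.symm k).1 = ∑ z ∈ T, Φ z :=
    (Fintype.sum_equiv T.equivFin.symm _ (fun t : ↥T => Φ t.1) fun _ => rfl).trans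
      (Finset.sum_coe_sort T Φ)
  rw [Finset.sum_erase_eq_sub hz₀, Finset.sum_erase_eq_sub (Finset.mem_univ _), h1]
  simp

/-- **Far tail of a separated point set as a `tsum`**: with `C ≥ 0` the far-tail constant of
`PricedHcpWindowsFarTail.stub_farTail` for `δ₀ > 0`, a set `S` of pairwise `≥ δ₀` separated points,
`z₀ ∈ S` and `ℓ ≥ δ₀`, every subfamily of `{z ∈ S ∖ {z₀} : |z₀ - z| ≥ ℓ}` has
`∑' |z₀ - z|⁻⁶ ≤ C ℓ⁻³` (every finite partial sum is a far tail of a finite separated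
configuration, `exists_fin_enum`). [folklore] -/
theorem tsum_far_le {X : Type*} [MetricSpace X] [DecidableEq X] {δ₀ C : ℝ} (hδ₀ : 0 < δ₀)
    (hC0 : 0 ≤ C) (hC : ∀ (N : ℕ) (y : Fin N → X), (∀ i j : Fin N, i ≠ j → δ₀ ≤ dist (y i) (y j)) →
      ∀ (i : Fin N) (ℓ : ℝ), δ₀ ≤ ℓ →
        ∑ j ∈ (Finset.univ.erase i).filter (fun j => ℓ ≤ dist (y i) (y j)),
          (dist (y i) (y j))⁻¹ ^ 6 ≤ C * ℓ⁻¹ ^ 3)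
    {S : Set X} (hS : ∀ z ∈ S, ∀ z' ∈ S, z ≠ z' → δ₀ ≤ dist z z') {z₀ : X} (hz₀ : z₀ ∈ S)
    {ℓ : ℝ} (hℓ : δ₀ ≤ ℓ) {p : {z // z ∈ S ∧ z ≠ z₀} → Prop} (hp : ∀ z, p z → ℓ ≤ dist z₀ z.1) :
    ∑' z : {z : {z // z ∈ S ∧ z ≠ z₀} // p z}, (dist z₀ z.1.1)⁻¹ ^ 6 ≤ C * ℓ⁻¹ ^ 3 := by
  have hℓ0 : 0 < ℓ := hδ₀.trans_le hℓ
  refine tsum_le_of_sum_le' (by positivity) fun s => ?_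
  have hinj : Set.InjOn (fun z : {z : {z // z ∈ S ∧ z ≠ z₀} // p z} => z.1.1) ↑s :=
    fun z _ z' _ hzz' => Subtype.ext (Subtype.ext hzz')
  obtain ⟨F, hF⟩ : ∃ F : Finset X,
      F = s.image (fun z : {z : {z // z ∈ S ∧ z ≠ z₀} // p z} => z.1.1) := ⟨_, rfl⟩
  have h1 : ∑ z ∈ s, (dist z₀ z.1.1)⁻¹ ^ 6 = ∑ x ∈ F, (dist z₀ x)⁻¹ ^ 6 := by
    rw [hF, Finset.sum_image hinj]
  have hFmem : ∀ x ∈ F, x ∈ S ∧ x ≠ z₀ ∧ ℓ ≤ dist z₀ x := by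
    intro x hx
    rw [hF] at hx
    obtain ⟨z, -, rfl⟩ := Finset.mem_image.1 hx
    exact ⟨z.1.2.1, z.1.2.2, hp z.1 z.2⟩
  have hz₀F : z₀ ∉ F := fun h0 => (hFmem z₀ h0).2.1 rfl
  have hTS : ∀ c ∈ insert z₀ F, c ∈ S := fun c hc => by
    rcases Finset.mem_insert.1 hc with rfl | hc
    exacts [hz₀, (hFmem c hc).1]
  rw [h1, ← Finset.erase_insert hz₀F]
  obtain ⟨N, y, i, hyi, hyinj, hmem, hsep', hsum⟩ := exists_fin_enum (insert z₀ F)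
    (Finset.mem_insert_self z₀ F) (fun c hc d hd hcd => hS c (hTS c hc) d (hTS d hd) hcd)
  have h := hC N y hsep' i ℓ hℓ
  rw [Finset.filter_true_of_mem, hyi, ← hsum (fun z => (dist z₀ z)⁻¹ ^ 6)] at h
  · exact h
  · intro k hk
    have hki : y k ≠ z₀ := fun h0 => Finset.ne_of_mem_erase hk (hyinj (h0.trans hyi.symm))
    rw [hyi]
    exact (hFmem _ ((Finset.mem_insert.1 (hmem k)).resolve_left hki)).2.2

/-! ## The estimate -/

/-- **Site energies of hcp-matched sites are `2 e(hcp)` up to `C (θ + ℓ⁻³)`.** For `a, h > 0`,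
`0 < δ₀ ≤ 1`, `δ₀ ≤ min a h` there is `C ≥ 0` such that for all `ℓ ≥ 2`, `0 < θ ≤ δ₀/4`, every
`δ₀`-separated `y : Fin N → ℝ³`, site `i`, rigid motion `g` and `z₀ ∈ S = barlowStacking a h
alternatingHagg` with `|y i - g z₀| ≤ θ`: if every `y j` with `|y i - y j| ≤ ℓ` is within `θ` of
some `g z` (`z ∈ S`) and every `g z` (`z ∈ S`) with `|y i - g z| ≤ ℓ` is within `θ` of some `y j`,
then `|𝓔ⁱ_LJ(y) - 2 e_LJ(hcp a h)| ≤ C (θ + ℓ⁻³)`. The lattice sum at `z₀` is `2 e_LJ(hcp)`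
(`two_mul_energyPerParticle_hcp`); the matching is injective near `i` and moves distances to the
centre by `≤ 2θ` (mean value theorem and shell sums for the matched part); unmatched points on
either side are at distance `≥ ℓ/2` from the centre (far tails). [folklore] -/
theorem stub_hcpMatchedSiteEnergy : ∀ (a h : ℝ) (ha : a ≠ 0) (hh : h ≠ 0), 0 < a → 0 < h → ∀ δ₀ : ℝ, 0 < δ₀ → δ₀ ≤ 1 → δ₀ ≤ min a h → ∃ C : ℝ, 0 ≤ C ∧ ∀ (ℓ θ : ℝ), 2 ≤ ℓ → 0 < θ → θ ≤ δ₀ / 4 → ∀ (N : ℕ) (y : Fin N → EuclideanSpace ℝ (Fin 3)), (∀ i j : Fin N, i ≠ j → δ₀ ≤ dist (y i) (y j)) → ∀ (i : Fin N) (g : EuclideanSpace ℝ (Fin 3) ≃ᵃⁱ[ℝ] EuclideanSpace ℝ (Fin 3)) (z₀ : EuclideanSpace ℝ (Fin 3)), z₀ ∈ Literature.MathematicalPhysics.StatisticalMechanics.barlowStacking a h Literature.MathematicalPhysics.StatisticalMechanics.alternatingHagg → dist (y i) (g z₀) ≤ θ → (∀ j : Fin N, dist (y i) (y j) ≤ ℓ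 → ∃ z ∈ Literature.MathematicalPhysics.StatisticalMechanics.barlowStacking a h Literature.MathematicalPhysics.StatisticalMechanics.alternatingHagg, dist (y j) (g z) ≤ θ) → (∀ z ∈ Literature.MathematicalPhysics.StatisticalMechanics.barlowStacking a h Literature.MathematicalPhysics.StatisticalMechanics.alternatingHagg, dist (y i) (g z) ≤ ℓ → ∃ j : Fin N, dist (y j) (g z) ≤ θ) → |Literature.MathematicalPhysics.StatisticalMechanics.siteEnergy Literature.MathematicalPhysics.StatisticalMechanics.lennardJones y i - 2 * (Literature.MathematicalPhysics.StatisticalMechanics.hcpPeriodicConfiguration ha hh).energyPerParticle Literature.MathematicalPhysics.StatisticalMechanics.lennardJones| ≤ C * (θ + ℓ⁻¹ ^ 3) := by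
  intro a h ha hh ha0 hh0 δ₀ hδ₀ hδ₁ hδah
  obtain ⟨CT, hCT0, hCT⟩ := PricedHcpWindowsFarTail.stub_farTail δ₀ hδ₀
  refine ⟨1000 * (δ₀⁻¹ ^ 7 + δ₀⁻¹) * δ₀⁻¹ ^ 6 + 16 * CT, by positivity, ?_⟩
  intro ℓ θ hℓ hθ hθδ N y hsep i g z₀ hz₀ hiz h1 h2
  have hθ4 : 4 * θ ≤ δ₀ := by linarith
  have hδℓ : δ₀ ≤ ℓ / 2 := by linarith
  have e8 : (ℓ / 2)⁻¹ ^ 3 = 8 * ℓ⁻¹ ^ 3 := by rw [inv_div, div_eq_mul_inv]; ring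
  have hg : ∀ p q, dist (g p) (g q) = dist p q := fun p q => g.dist_map p q
  -- the lattice sum at `z₀`, its summability, the separation of `S`
  rw [two_mul_energyPerParticle_hcp ha0 hh0 ha hh hz₀]
  have hpts : (hcpPeriodicConfiguration ha hh).points = barlowStacking a h alternatingHagg :=
    hcpPeriodicConfiguration_points ha hh
  set S := barlowStacking a h alternatingHagg with hS_def
  have hSsep : ∀ z ∈ S, ∀ z' ∈ S, z ≠ z' → δ₀ ≤ dist z z' := fun z hz z' hz' hne =>
    hδah.trans (le_dist_of_mem_barlowStacking a h alternatingHagg ha0.le hh0.le hz hz' hne)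
  have hsumV : Summable fun z : {z // z ∈ S ∧ z ≠ z₀} => lennardJones (dist z₀ z.1) := by
    have := (hcpPeriodicConfiguration ha hh).summable_lennardJones_dist_three z₀
    rwa [hpts] at this
  have hsum6 : Summable fun z : {z // z ∈ S ∧ z ≠ z₀} => (dist z₀ z.1)⁻¹ ^ 6 := by
    have := (hcpPeriodicConfiguration ha hh).summable_inv_pow_six_dist (by norm_num) z₀
    rwa [hpts] at this
  -- the matching map `m`
  have h1' : ∀ j : Fin N, ∃ z, z ∈ S ∧ (dist (y i) (y j) ≤ ℓ → dist (y j) (g z) ≤ θ) := by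
    intro j
    by_cases hj : dist (y i) (y j) ≤ ℓ
    · obtain ⟨z, hz, hjz⟩ := h1 j hj
      exact ⟨z, hz, fun _ => hjz⟩
    · exact ⟨z₀, hz₀, fun h' => absurd h' hj⟩
  choose m hmS hm using h1'
  -- matched points have almost the same distance to the centre
  have hcomp : ∀ j z, dist (y j) (g z) ≤ θ →
      |dist z₀ z - dist (y i) (y j)| ≤ 2 * θ := by
    intro j z hjz
    have t1 := abs_dist_sub_le (g z₀) (y i) (g z)
    have t2 := abs_dist_sub_le (g z) (y j) (y i)
    rw [hg, dist_comm (g z₀) (y i)] at t1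
    rw [dist_comm (g z) (y i), dist_comm (y j) (y i), dist_comm (g z) (y j)] at t2
    rw [abs_le] at t1 t2 ⊢
    constructor <;> linarith [t1.1, t1.2, t2.1, t2.2]
  -- matched partners are not the centre `z₀`
  have hmz : ∀ j, j ≠ i → dist (y i) (y j) ≤ ℓ → m j ≠ z₀ := by
    intro j hji hjℓ heq
    have hmj := hm j hjℓ
    rw [heq] at hmj
    have hsp := hsep i j hji.symm
    have htri := dist_triangle (y i) (g z₀) (y j)
    rw [dist_comm (g z₀) (y j)] at htri
    linarith
  -- the matching is injective on the `ℓ`-ball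
  have hminj : ∀ j k, dist (y i) (y j) ≤ ℓ → dist (y i) (y k) ≤ ℓ → m j = m k → j = k := by
    intro j k hj hk hjk
    by_contra hne
    have hsp := hsep j k hne
    have hj' := hm j hj
    have hk' := hm k hk
    rw [hjk] at hj'
    have htri := dist_triangle (y j) (g (m k)) (y k)
    rw [dist_comm (g (m k)) (y k)] at htri
    linarith
  -- the matched index set `SF`, the remainder `R`, the matched lattice points `M`, `sM`
  obtain ⟨SF, hSF_def⟩ : ∃ SF : Finset (Fin N),
      SF = (Finset.univ.erase i).filter (fun j => dist (y i) (y j) ≤ ℓ - 2 * θ) := ⟨_, rfl⟩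
  obtain ⟨R, hR_def⟩ : ∃ R : Finset (Fin N),
      R = (Finset.univ.erase i).filter (fun j => ¬ dist (y i) (y j) ≤ ℓ - 2 * θ) := ⟨_, rfl⟩
  have hSF : ∀ j ∈ SF, j ≠ i ∧ dist (y i) (y j) ≤ ℓ := fun j hj => by
    rw [hSF_def] at hj
    obtain ⟨hj1, hj2⟩ := Finset.mem_filter.1 hj
    exact ⟨Finset.ne_of_mem_erase hj1, by linarith⟩
  have hSFinj : Set.InjOn m SF := fun j hj k hk hjk =>
    hminj j k (hSF j hj).2 (hSF k hk).2 hjk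
  classical
  obtain ⟨M, hM_def⟩ : ∃ M, M = SF.image m := ⟨_, rfl⟩
  have hM : ∀ z ∈ M, z ∈ S ∧ z ≠ z₀ := by
    intro z hz
    rw [hM_def] at hz
    obtain ⟨j, hj, rfl⟩ := Finset.mem_image.1 hz
    exact ⟨hmS j, hmz j (hSF j hj).1 (hSF j hj).2⟩
  have hz₀M : z₀ ∉ M := fun h0 => (hM z₀ h0).2 rfl
  have hMsep : ∀ c ∈ insert z₀ M, ∀ d ∈ insert z₀ M, c ≠ d → δ₀ ≤ dist c d := by
    have hmemS : ∀ c ∈ insert z₀ M, c ∈ S := fun c hc => by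
      rcases Finset.mem_insert.1 hc with rfl | hc
      exacts [hz₀, (hM c hc).1]
    exact fun c hc d hd hcd => hSsep c (hmemS c hc) d (hmemS d hd) hcd
  obtain ⟨sM, hsM_def⟩ : ∃ sM : Finset {z // z ∈ S ∧ z ≠ z₀},
      sM = M.subtype (fun z => z ∈ S ∧ z ≠ z₀) := ⟨_, rfl⟩
  have hsM_sum : ∀ Φ : EuclideanSpace ℝ (Fin 3) → ℝ,
      ∑ z ∈ sM, Φ z.1 = ∑ j ∈ SF, Φ (m j) := by
    intro Φ
    rw [hsM_def, Finset.sum_subtype_of_mem Φ hM, hM_def, Finset.sum_image hSFinj]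
  -- decompositions of the two energies
  have hE : siteEnergy lennardJones y i =
      ∑ j ∈ SF, lennardJones (dist (y i) (y j)) +
        ∑ j ∈ R, lennardJones (dist (y i) (y j)) := by
    rw [siteEnergy, hSF_def, hR_def]
    exact (Finset.sum_filter_add_sum_filter_not _ _ _).symm
  have hT : ∑' z : {z // z ∈ S ∧ z ≠ z₀}, lennardJones (dist z₀ z.1) =
      ∑ j ∈ SF, lennardJones (dist z₀ (m j)) +
        ∑' z : {z : {z // z ∈ S ∧ z ≠ z₀} // z ∉ sM}, lennardJones (dist z₀ z.1.1) := by
    rw [← hsumV.sum_add_tsum_subtype_compl sM, hsM_sum (fun z => lennardJones (dist z₀ z))]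
  -- (A) the matched part
  have hA : ∀ j ∈ SF, |lennardJones (dist (y i) (y j)) - lennardJones (dist z₀ (m j))| ≤
      (δ₀⁻¹ ^ 7 + δ₀⁻¹) * (2 * θ) * ((dist (y i) (y j))⁻¹ ^ 6 + (dist z₀ (m j))⁻¹ ^ 6) := by
    intro j hj
    obtain ⟨hji, hjℓ⟩ := hSF j hj
    have ha' : δ₀ ≤ dist (y i) (y j) := hsep i j hji.symm
    have hb' : δ₀ ≤ dist z₀ (m j) := hSsep z₀ hz₀ (m j) (hmS j) (hmz j hji hjℓ).symm
    have hd : |dist (y i) (y j) - dist z₀ (m j)| ≤ 2 * θ := by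
      rw [abs_sub_comm]
      exact hcomp j (m j) (hm j hjℓ)
    have hpos : 0 ≤ (δ₀⁻¹ ^ 7 + δ₀⁻¹) *
        ((dist (y i) (y j))⁻¹ ^ 6 + (dist z₀ (m j))⁻¹ ^ 6) := by positivity
    calc _ ≤ (δ₀⁻¹ ^ 7 + δ₀⁻¹) * ((dist (y i) (y j))⁻¹ ^ 6 + (dist z₀ (m j))⁻¹ ^ 6) *
          |dist (y i) (y j) - dist z₀ (m j)| := abs_lennardJones_sub_le hδ₀ ha' hb'
      _ ≤ (δ₀⁻¹ ^ 7 + δ₀⁻¹) * ((dist (y i) (y j))⁻¹ ^ 6 + (dist z₀ (m j))⁻¹ ^ 6) *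
          (2 * θ) := mul_le_mul_of_nonneg_left hd hpos
      _ = _ := by ring
  have hsumA : ∑ j ∈ SF, |lennardJones (dist (y i) (y j)) - lennardJones (dist z₀ (m j))| ≤
      (δ₀⁻¹ ^ 7 + δ₀⁻¹) * (2 * θ) * (250 * δ₀⁻¹ ^ 6 + 250 * δ₀⁻¹ ^ 6) := by
    have h6 := sum_inv_pow_six_le y hδ₀ hsep i
    have hsub1 : ∑ j ∈ SF, (dist (y i) (y j))⁻¹ ^ 6 ≤
        ∑ j ∈ Finset.univ.erase i, (dist (y i) (y j))⁻¹ ^ 6 :=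
      Finset.sum_le_sum_of_subset_of_nonneg (hSF_def ▸ Finset.filter_subset _ _)
        fun _ _ _ => by positivity
    -- the lattice side: enumerate `insert z₀ M` and use the shell sum
    have hT6 : ∑ j ∈ SF, (dist z₀ (m j))⁻¹ ^ 6 ≤ 250 * δ₀⁻¹ ^ 6 := by
      obtain ⟨N', y', i', hyi, -, -, hsep', hsum⟩ :=
        exists_fin_enum (insert z₀ M) (Finset.mem_insert_self z₀ M) hMsep
      have h0 := sum_inv_pow_six_le y' hδ₀ hsep' i'
      rwa [hyi, ← hsum (fun z => (dist z₀ z)⁻¹ ^ 6), Finset.erase_insert hz₀M, hM_def,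
        Finset.sum_image hSFinj] at h0
    calc _ ≤ ∑ j ∈ SF, (δ₀⁻¹ ^ 7 + δ₀⁻¹) * (2 * θ) *
          ((dist (y i) (y j))⁻¹ ^ 6 + (dist z₀ (m j))⁻¹ ^ 6) := Finset.sum_le_sum hA
      _ = (δ₀⁻¹ ^ 7 + δ₀⁻¹) * (2 * θ) * (∑ j ∈ SF, (dist (y i) (y j))⁻¹ ^ 6 +
          ∑ j ∈ SF, (dist z₀ (m j))⁻¹ ^ 6) := by
          rw [← Finset.mul_sum, Finset.sum_add_distrib]
      _ ≤ (δ₀⁻¹ ^ 7 + δ₀⁻¹) * (2 * θ) * (250 * δ₀⁻¹ ^ 6 + 250 * δ₀⁻¹ ^ 6) :=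
          mul_le_mul_of_nonneg_left (add_le_add (hsub1.trans h6) hT6) (by positivity)
  -- (B) the remainder in `y`
  have hsumB : ∑ j ∈ R, |lennardJones (dist (y i) (y j))| ≤ 8 * CT * ℓ⁻¹ ^ 3 := by
    have hRfar : ∀ j ∈ R, ℓ - 2 * θ < dist (y i) (y j) := fun j hj => by
      rw [hR_def] at hj
      exact not_le.1 (Finset.mem_filter.1 hj).2
    have hRsub : R ⊆ (Finset.univ.erase i).filter (fun j => ℓ / 2 ≤ dist (y i) (y j)) := by
      intro j hj
      have hfar := hRfar j hj
      rw [hR_def] at hj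
      exact Finset.mem_filter.2 ⟨(Finset.mem_filter.1 hj).1, by linarith⟩
    have h0 := hCT N y hsep i (ℓ / 2) hδℓ
    rw [e8] at h0
    calc ∑ j ∈ R, |lennardJones (dist (y i) (y j))| ≤ ∑ j ∈ R, (dist (y i) (y j))⁻¹ ^ 6 :=
          Finset.sum_le_sum fun j hj => abs_lennardJones_le_of_one_le (by linarith [hRfar j hj])
      _ ≤ ∑ j ∈ (Finset.univ.erase i).filter (fun j => ℓ / 2 ≤ dist (y i) (y j)),
            (dist (y i) (y j))⁻¹ ^ 6 :=
          Finset.sum_le_sum_of_subset_of_nonneg hRsub fun _ _ _ => by positivity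
      _ ≤ 8 * CT * ℓ⁻¹ ^ 3 := h0.trans_eq (by ring)
  -- (C) the remainder on the lattice side: unmatched lattice points are far from `z₀`
  have hCfar : ∀ z : {z // z ∈ S ∧ z ≠ z₀}, z ∉ sM → ℓ - 4 * θ < dist z₀ z.1 := by
    intro z hz
    have hzM : z.1 ∉ M := fun h' => hz (by rw [hsM_def]; exact Finset.mem_subtype.2 h')
    by_contra hle
    rw [not_lt] at hle
    have hzi : dist (y i) (g z.1) ≤ ℓ := by
      have htri := dist_triangle (y i) (g z₀) (g z.1)
      rw [hg] at htri
      linarith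
    obtain ⟨j, hj⟩ := h2 z.1 z.2.1 hzi
    have hzsep : δ₀ ≤ dist z₀ z.1 := hSsep z₀ hz₀ z.1 z.2.1 (Ne.symm z.2.2)
    have hji : j ≠ i := by
      intro hji
      rw [hji] at hj
      have htri := dist_triangle (g z₀) (y i) (g z.1)
      rw [hg, dist_comm (g z₀) (y i)] at htri
      linarith
    have hc := hcomp j z.1 hj
    have hij : dist (y i) (y j) ≤ ℓ - 2 * θ := by
      rw [abs_le] at hc
      linarith [hc.1]
    have hjS : j ∈ SF :=
      hSF_def ▸ Finset.mem_filter.2 ⟨Finset.mem_erase.2 ⟨hji, Finset.mem_univ _⟩, hij⟩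
    have hmj := hm j (by linarith)
    have hmj' : m j = z.1 := by
      by_contra hne
      have hfar := hSsep (m j) (hmS j) z.1 z.2.1 hne
      have htri := dist_triangle (g (m j)) (y j) (g z.1)
      rw [hg, dist_comm (g (m j)) (y j)] at htri
      linarith
    exact hzM (hM_def ▸ Finset.mem_image.2 ⟨j, hjS, hmj'⟩)
  have hsumC : |∑' z : {z : {z // z ∈ S ∧ z ≠ z₀} // z ∉ sM}, lennardJones (dist z₀ z.1.1)| ≤
      8 * CT * ℓ⁻¹ ^ 3 := by
    have hVs : Summable fun z : {z : {z // z ∈ S ∧ z ≠ z₀} // z ∉ sM} =>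
        lennardJones (dist z₀ z.1.1) := hsumV.subtype _
    have h6s : Summable fun z : {z : {z // z ∈ S ∧ z ≠ z₀} // z ∉ sM} =>
        (dist z₀ z.1.1)⁻¹ ^ 6 := hsum6.subtype _
    have hle : ∀ z : {z : {z // z ∈ S ∧ z ≠ z₀} // z ∉ sM},
        |lennardJones (dist z₀ z.1.1)| ≤ (dist z₀ z.1.1)⁻¹ ^ 6 := fun z =>
      abs_lennardJones_le_of_one_le (by linarith [hCfar z.1 z.2])
    have htail := tsum_far_le hδ₀ hCT0 hCT hSsep hz₀ hδℓ (p := fun z => z ∉ sM)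
      (fun z hz => by linarith [hCfar z hz])
    rw [e8] at htail
    have hup := hVs.tsum_le_tsum (fun z => (abs_le.1 (hle z)).2) h6s
    have hlow := h6s.neg.tsum_le_tsum (fun z => (abs_le.1 (hle z)).1) hVs
    rw [tsum_neg] at hlow
    rw [abs_le]
    constructor <;> linarith
  -- assembly
  have hdiff : siteEnergy lennardJones y i -
      ∑' z : {z // z ∈ S ∧ z ≠ z₀}, lennardJones (dist z₀ z.1) =
      ∑ j ∈ SF, (lennardJones (dist (y i) (y j)) - lennardJones (dist z₀ (m j))) +
        (∑ j ∈ R, lennardJones (dist (y i) (y j)) -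
          ∑' z : {z : {z // z ∈ S ∧ z ≠ z₀} // z ∉ sM}, lennardJones (dist z₀ z.1.1)) := by
    rw [hE, hT, Finset.sum_sub_distrib]
    ring
  have hx1 := (Finset.abs_sum_le_sum_abs _ _).trans hsumA
  have hx2 := (Finset.abs_sum_le_sum_abs _ _).trans hsumB
  rw [hdiff]
  refine (abs_add_sub_le_three _ _ _).trans ?_
  have hKn : 0 ≤ 1000 * (δ₀⁻¹ ^ 7 + δ₀⁻¹) * δ₀⁻¹ ^ 6 * ℓ⁻¹ ^ 3 := by positivity
  have hCn : 0 ≤ 16 * CT * θ := by positivity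
  linarith

end Summit.AtomisticToContinuum.Crystallization.Theorems.PricedHcpWindowsMatchedEnergy
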